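import Mathlib.GroupTheory.Coset.Basic
import Mathlib.GroupTheory.Coset.Card
import Mathlib.Data.Set.Card
import Literature.Combinatorics.Additive.TripleProductProperty
import Literature.Computability.AlgebraicComplexity.CohnUmansDihedralSubgroupTPP
import HarnessLib

/-!
# Subtransversals and the triple product property (Hedtke–Murthy 2012, Def. 3.2, Thm. 3.3, Obs. 3.4, Thm. 3.5)

Topic `Literature/Computability/AlgebraicComplexity` (family `MatrixMultiplication`, the Cohn–Umans
group-theoretic approach; companions: `TPPBasicTripleCriterion.lean` = Thm. 3.1 of the same paper,
`CohnUmansDihedralSubgroupTPP.lean` for `SubgroupTPP`).  Source: I. Hedtke, S. Murthy, *Search and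
test algorithms for triple product property triples*, Groups Complex. Cryptol. 4 (2012) 111–133,
doi:10.1515/gcc-2012-0006 = arXiv:1104.5097 [HedtkeMurthy2012], §3 (held text
`paper:arxiv-1104.5097`, chunk p0006 L25–80), read first-hand.  Verbatim:

> **Definition 3.2 (subtransversal, support).** Let `C` be a finite nonempty set and
> `𝒞 = {C₁, …, C_k}` a partition of it. A set `X ⊆ C` is called a subtransversal for `𝒞` with support
> `supp_𝒞(X) = 𝒯 ⊆ 𝒞` if for all `Cᵢ ∈ 𝒞`, `|X ∩ Cᵢ| = 1` if `Cᵢ ∈ 𝒯`, `0` otherwise. It then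
> follows that `|X| = |𝒯|`. In the special case when the collection `𝒞` is the set of left (or right)
> cosets of a subgroup `S` of a group `G`, then any subtransversal `T` for `G/S` (or `S\G`) will
> simply be called a subtransversal for `S` in `G`.
> **Theorem 3.3.** Let `G` be a group, `S` a subgroup of `G`, and `T`, `U` subsets of `G`.
> • If `(S,T,U)` is a basic TPP triple of `G` then `T` and `U` are subtransversals for `S` in `G`
>   such that `supp_{S\G}(T) ∩ supp_{S\G}(U) = {S}`.  (eq:Green)
> • If `T` and `U` are also subgroups of `G`, and `T` and `U` are subtransversals for `S` in `G`
>   satisfying (eq:Green) then `(S,T,U)` is a TPP triple of `G`.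
> **Observation 3.4.** Three subgroups `S`, `T`, `U` of a group `G` form a TPP triple iff `T` and
> `U` are subtransversals for `S` in `G`, satisfying (eq:Green).
> **Theorem 3.5.** Let `G` be a group. If `(S,T,U)` is a TPP triple of subgroups where at least one
> of `S`, `T` or `U` is normal in `G`, then `|S|·|T|·|U| ≤ |G|`.

Printed proof of Thm. 3.3 (i): "`S ∩ T = S ∩ U = 1` by (***). Let `S ≠ Sr ∈ S\G` … distinct
`1 ≠ t, t' ∈ T ∩ Sr`, `t = sr`, `t' = s'r` … `1 ≠ t't⁻¹ = s's⁻¹ ∈ S ∩ Q(T)`, and that contradicts the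
TPP requirement (**) … Now assume `1 ≠ t = sr ∈ T ∩ Sr` and `1 ≠ u = s'r ∈ U ∩ Sr` for a nontrivial
coset `Sr ≠ S`. Then `1 ≠ tu⁻¹ = s(s')⁻¹ ∈ Q(S) ∩ Q(T)Q(U)`" (contradicting Thm. 3.1 (iii)).
(ii): "Since `S`, `T` and `U` are subgroups we have `1 ∈ S ∩ T ∩ U` … Because the intersection of the
supports of `T` and `U` is `{S}`, `T ∩ U = 1` holds. Now assume that there is an `1 ≠ x ∈ S ∩ TU` …
`tu ∈ S`, which is equivalent to `t ∈ Su⁻¹`. But then would be `t = u = 1`".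
Thm. 3.5: "`𝒯 := supp_{G/S}(T)` and `𝒰` … are subgroups of `G/S` with `|𝒯| = |T|`, `|𝒰| = |U|` and
`𝒯 ∩ 𝒰 = 1` … It follows that `|𝒯𝒰| = |𝒯|·|𝒰|/|𝒯 ∩ 𝒰| = |T|·|U|`, and because `𝒯𝒰 ⊆ G/S`
we have `|T||U| ≤ |G|/|S|`."

## Conventions and what is formalised (everything PROVED; two definitions)

The TPP is the tree's right-quotient `TripleProductProperty` (`Q(X) = X X⁻¹`, Cohn–Umans Def. 2.1 =
the paper's Def. 1.2), so the cosets are the RIGHT cosets `S\G = {Sg}`: `x, y` lie in one right coset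
iff `x y⁻¹ ∈ S` (Mathlib `QuotientGroup.rightRel S`, `rightRel S y x ↔ x y⁻¹ ∈ S`).  A *basic* triple
has `1 ∈ S ∩ T ∩ U` (Def. 2.8).  For a subgroup `S` we use both the `Subgroup` and its finite set
`{g | g ∈ S}`; three subgroups with the TPP are the tree's `SubgroupTPP`
(`CohnUmansDihedralSubgroupTPP.lean`, equivalent to `TripleProductProperty` of the carriers).

* `HedtkeMurthy2012.IsSubtransversal S X` — Def. 3.2 for `S\G`: every right coset of `S` meets `X` in
  at most one point (`x, y ∈ X`, `x y⁻¹ ∈ S ⇒ x = y`); `HedtkeMurthy2012.support S X ⊆ S\G` — the set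
  of right cosets met by `X`; `IsSubtransversal.ncard_support` ("`|X| = |𝒯|`").
* `HedtkeMurthy2012_thm33_1` — Thm. 3.3, first bullet (for a basic TPP triple `({g ∈ S}, T, U)`);
  `HedtkeMurthy2012_thm33_2` — second bullet (subgroups `S, T, U`); `HedtkeMurthy2012_obs34` —
  Obs. 3.4 as an `iff` for three subgroups.
* `HedtkeMurthy2012_thm35_left` (`S` normal) and `HedtkeMurthy2012_thm35` (as printed: one of
  `S, T, U` normal ⇒ `|S||T||U| ≤ |G|`, via the cyclic symmetry of the TPP), by the count behind the
  printed route `|T||U| = |𝒯𝒰| ≤ |G/S|`: `(t, u) ↦ (tu)S` is injective on `T × U`;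
  `HedtkeMurthy2012.inf_eq_bot_of_subgroupTPP` (`S ∩ T = 1`, Lemma 2.1 (***)).  (The same inequality is the tree's
  `Murthy2026_prop26_2_subgroup`, `SubgroupTPPQuotient.lean`, with the same proof; BCGPU 2023
  Thm. 3.6, `NormalizerBarrier.lean`, is the quantitative version.)

## References
* [HedtkeMurthy2012] I. Hedtke, S. Murthy, arXiv:1104.5097 = Groups Complex. Cryptol. 4 (2012),
  Def. 3.2, Thm. 3.3, Obs. 3.4, Thm. 3.5 (with proofs), Def. 2.8, Lemma 2.1.
* [CohnUmans2003] H. Cohn, C. Umans, FOCS 2003, Def. 2.1 (TPP; subgroup case).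
-/

open Finset
open scoped Pointwise

namespace Literature.Computability.AlgebraicComplexity

open Literature.Combinatorics.Additive DihedralSubgroups

variable {G : Type*} [Group G]

namespace HedtkeMurthy2012

/-- **Subtransversal for `S` in `G`** (Hedtke–Murthy 2012, Def. 3.2, for the right cosets `S\G`):
a finite set `X ⊆ G` meeting every right coset `Sg` in at most one element — `x, y ∈ X` with
`Sx = Sy`, i.e. `x y⁻¹ ∈ S`, forces `x = y`. [cite: HedtkeMurthy2012, Definition 3.2] -/
def IsSubtransversal (S : Subgroup G) (X : Finset G) : Prop :=
  ∀ ⦃x⦄, x ∈ X → ∀ ⦃y⦄, y ∈ X → x * y⁻¹ ∈ S → x = y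

/-- **Support** `supp_{S\G}(X)` of a finite set `X` (Def. 3.2): the set of right cosets `Sx`, `x ∈ X`,
as points of `S\G = Quotient (QuotientGroup.rightRel S)`. [cite: HedtkeMurthy2012, Definition 3.2] -/
def support (S : Subgroup G) (X : Finset G) : Set (Quotient (QuotientGroup.rightRel S)) :=
  {q | ∃ x ∈ X, Quotient.mk'' x = q}

variable {S : Subgroup G} {X : Finset G}

/-- Two elements give the same right coset iff `x y⁻¹ ∈ S` (Mathlib's `rightRel`, unfolded). [folklore] -/
private theorem mk_eq_mk_iff {x y : G} :
    (Quotient.mk'' x : Quotient (QuotientGroup.rightRel S)) = Quotient.mk'' y ↔ x * y⁻¹ ∈ S := by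
  rw [Quotient.eq'']
  show QuotientGroup.rightRel S x y ↔ _
  rw [QuotientGroup.rightRel_apply]
  rw [← S.inv_mem_iff, mul_inv_rev, inv_inv]

/-- The coset of an element of `X` lies in the support of `X`. [folklore] -/
private theorem mk_mem_support {x : G} (hx : x ∈ X) :
    (Quotient.mk'' x : Quotient (QuotientGroup.rightRel S)) ∈ support S X := ⟨x, hx, rfl⟩

/-- The trivial coset `S = S·1` lies in the support iff `X` meets `S`. [cite: HedtkeMurthy2012, Definition 3.2] -/
theorem one_mem_support_iff :
    (Quotient.mk'' (1 : G) : Quotient (QuotientGroup.rightRel S)) ∈ support S X ↔ ∃ x ∈ X, x ∈ S := by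
  constructor
  · rintro ⟨x, hx, h⟩
    exact ⟨x, hx, by simpa using mk_eq_mk_iff.1 h⟩
  · rintro ⟨x, hx, hxS⟩
    exact ⟨x, hx, mk_eq_mk_iff.2 (by simpa using hxS)⟩

/-- "It then follows that `|X| = |𝒯|`": a subtransversal is in bijection with its support.
[cite: HedtkeMurthy2012, Definition 3.2] -/
theorem IsSubtransversal.ncard_support (h : IsSubtransversal S X) : (support S X).ncard = X.card := by
  classical
  have : support S X = (fun x : G => (Quotient.mk'' x : Quotient (QuotientGroup.rightRel S))) '' ↑X := by
    ext q; simp [support]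
  rw [this, Set.InjOn.ncard_image, Set.ncard_coe_finset]
  intro x hx y hy hxy
  exact h hx hy (mk_eq_mk_iff.1 hxy)

end HedtkeMurthy2012

open HedtkeMurthy2012

section Subsets

variable (S : Subgroup G) [DecidablePred (· ∈ S)] [Fintype G]

/-- **Hedtke–Murthy 2012, Thm. 3.3, first part.** If `(S, T, U)` is a basic TPP triple with `S` a
subgroup (`1 ∈ T`, `1 ∈ U`), then `T` and `U` are subtransversals for `S` in `G` and
`supp_{S\G}(T) ∩ supp_{S\G}(U) = {S}`.  Printed proof: two elements of `T` in one coset `Sr` give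
`t' t⁻¹ = s' s⁻¹ ∈ S ∩ Q(T)`; a common nontrivial coset gives `t u⁻¹ = s (s')⁻¹ ∈ Q(S) ∩ Q(T)Q(U)`.
[cite: HedtkeMurthy2012, Theorem 3.3] -/
theorem HedtkeMurthy2012_thm33_1 {T U : Finset G}
    (h : TripleProductProperty (univ.filter (· ∈ S)) T U) (hT : (1 : G) ∈ T) (hU : (1 : G) ∈ U) :
    IsSubtransversal S T ∧ IsSubtransversal S U ∧
      support S T ∩ support S U = {Quotient.mk'' 1} := by
  have memS : ∀ {g : G}, g ∈ S → g ∈ univ.filter (· ∈ S) := fun hg => by simpa using hg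
  refine ⟨fun t ht t' ht' hs => ?_, fun u hu u' hu' hs => ?_, ?_⟩
  · -- `s := t t'⁻¹ ∈ S`: the TPP word `(1·s⁻¹)(t t'⁻¹)(1·1⁻¹) = 1`
    have hw : (1 : G) * (t * t'⁻¹)⁻¹ * (t * t'⁻¹) * (1 * (1 : G)⁻¹) = 1 := by group
    exact (h 1 (memS S.one_mem) _ (memS hs) t ht t' ht' 1 hU 1 hU hw).2.1
  · -- `s := u u'⁻¹ ∈ S`: the TPP word `(1·s⁻¹)(1·1⁻¹)(u u'⁻¹) = 1`
    have hw : (1 : G) * (u * u'⁻¹)⁻¹ * (1 * (1 : G)⁻¹) * (u * u'⁻¹) = 1 := by group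
    exact (h 1 (memS S.one_mem) _ (memS hs) 1 hT 1 hT u hu u' hu' hw).2.2
  · ext q
    simp only [Set.mem_inter_iff, Set.mem_singleton_iff]
    constructor
    · rintro ⟨⟨t, ht, rfl⟩, ⟨u, hu, htu⟩⟩
      -- `St = Su`: `s := u t⁻¹ ∈ S` and `s · t · u⁻¹ = 1` is the TPP word `(s·1⁻¹)(t·1⁻¹)(1·u⁻¹)`
      have hs : u * t⁻¹ ∈ S := mk_eq_mk_iff.1 htu
      have hw : u * t⁻¹ * (1 : G)⁻¹ * (t * (1 : G)⁻¹) * (1 * u⁻¹) = 1 := by group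
      have := h _ (memS hs) 1 (memS S.one_mem) t ht 1 hT 1 hU u hu hw
      rw [this.2.1]
    · rintro rfl
      exact ⟨mk_mem_support hT, mk_mem_support hU⟩

end Subsets

section Subgroups

variable (S T U : Subgroup G)

/-- **Hedtke–Murthy 2012, Thm. 3.3, second part.** If `S, T, U` are subgroups and `T`, `U` (as sets)
are subtransversals for `S` in `G` whose supports meet only in `{S}`, then `(S, T, U)` is a TPP triple.
Printed proof: `1 ≠ x = s = tu ∈ S ∩ TU` gives `t ∈ S u⁻¹`, "but then would be `t = u = 1`".
[cite: HedtkeMurthy2012, Theorem 3.3] -/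
theorem HedtkeMurthy2012_thm33_2 [Fintype G] [DecidablePred (· ∈ T)]
    [DecidablePred (· ∈ U)]
    (hT : IsSubtransversal S (univ.filter (· ∈ T))) (hU : IsSubtransversal S (univ.filter (· ∈ U)))
    (hTU : support S (univ.filter (· ∈ T)) ∩ support S (univ.filter (· ∈ U)) = {Quotient.mk'' 1}) :
    SubgroupTPP S T U := by
  have memT : ∀ {g : G}, g ∈ T → g ∈ univ.filter (· ∈ T) := fun hg => by simpa using hg
  have memU : ∀ {g : G}, g ∈ U → g ∈ univ.filter (· ∈ U) := fun hg => by simpa using hg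
  intro a ha b hb c hc habc
  -- `b c = a⁻¹ ∈ S`, so the cosets `S b` and `S c⁻¹` coincide: a common point of the two supports
  have hbc : b * (c⁻¹)⁻¹ ∈ S := by
    rw [inv_inv]
    have : b * c = a⁻¹ := by
      rw [eq_inv_iff_mul_eq_one]
      have h1 : a⁻¹ * (a * b * c) * a = b * c * a := by group
      rw [← h1, habc, mul_one, inv_mul_cancel]
    rw [this]
    exact S.inv_mem ha
  have hq : (Quotient.mk'' b : Quotient (QuotientGroup.rightRel S)) ∈
      support S (univ.filter (· ∈ T)) ∩ support S (univ.filter (· ∈ U)) :=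
    ⟨mk_mem_support (memT hb), ⟨c⁻¹, memU (U.inv_mem hc), (mk_eq_mk_iff.2 hbc).symm⟩⟩
  rw [hTU, Set.mem_singleton_iff, mk_eq_mk_iff, inv_one, mul_one] at hq
  -- `b ∈ S ∩ T`, hence `b = 1` (subtransversality of `T` on the coset `S` itself); then `c ∈ S ∩ U`
  have hb1 : b = 1 := hT (memT hb) (memT T.one_mem) (by simpa using hq)
  subst hb1
  have hcS : c⁻¹ ∈ S := by simpa using hbc
  have hc1 : c⁻¹ = 1 := hU (memU (U.inv_mem hc)) (memU U.one_mem) (by simpa using hcS)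
  rw [inv_eq_one] at hc1
  subst hc1
  refine ⟨by simpa using habc, rfl, rfl⟩

/-- **Hedtke–Murthy 2012, Observation 3.4.** Three subgroups `S, T, U` form a TPP triple iff `T` and
`U` are subtransversals for `S` in `G` with `supp_{S\G}(T) ∩ supp_{S\G}(U) = {S}`.
[cite: HedtkeMurthy2012, Observation 3.4] -/
theorem HedtkeMurthy2012_obs34 [Fintype G] [DecidablePred (· ∈ S)]
    [DecidablePred (· ∈ T)] [DecidablePred (· ∈ U)] :
    SubgroupTPP S T U ↔
      IsSubtransversal S (univ.filter (· ∈ T)) ∧ IsSubtransversal S (univ.filter (· ∈ U)) ∧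
        support S (univ.filter (· ∈ T)) ∩ support S (univ.filter (· ∈ U)) = {Quotient.mk'' 1} := by
  constructor
  · intro h
    have h' : TripleProductProperty (univ.filter (· ∈ S)) (univ.filter (· ∈ T))
        (univ.filter (· ∈ U)) := by
      intro s hs s' hs' t ht t' ht' u hu u' hu' he
      simp only [Finset.mem_filter, Finset.mem_univ, true_and] at hs hs' ht ht' hu hu'
      obtain ⟨h1, h2, h3⟩ := h _ (S.mul_mem hs (S.inv_mem hs')) _ (T.mul_mem ht (T.inv_mem ht'))
        _ (U.mul_mem hu (U.inv_mem hu')) he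
      exact ⟨mul_inv_eq_one.1 h1, mul_inv_eq_one.1 h2, mul_inv_eq_one.1 h3⟩
    exact HedtkeMurthy2012_thm33_1 S h' (by simp) (by simp)
  · rintro ⟨hT, hU, hTU⟩
    exact HedtkeMurthy2012_thm33_2 S T U hT hU hTU

end Subgroups

/-! ### Theorem 3.5: a normal member makes the triple trivial -/

section Normal

variable {S T U : Subgroup G}

/-- In a subgroup TPP triple the members meet pairwise trivially (`(***)`: `S ∩ T = 1`).
[cite: HedtkeMurthy2012, Lemma 2.1] -/
theorem HedtkeMurthy2012.inf_eq_bot_of_subgroupTPP (h : SubgroupTPP S T U) : S ⊓ T = ⊥ := by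
  rw [eq_bot_iff]
  intro x hx
  have := h x hx.1 x⁻¹ (T.inv_mem hx.2) 1 U.one_mem (by simp)
  exact this.1

/-- The subgroup TPP is invariant under the cyclic shift `(S, T, U) ↦ (T, U, S)` (`abc = 1 ⟺ bca = 1`;
the paper's Lemma 2.4 / permutation invariance). [folklore] -/
private theorem subgroupTPP_rotate' (h : SubgroupTPP S T U) : SubgroupTPP T U S := by
  intro b hb c hc a ha hbca
  have h' : a * b * c = 1 := by
    have : a * (b * c * a) * a⁻¹ = 1 := by rw [hbca, mul_one, mul_inv_cancel]
    simpa [mul_assoc] using this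
  obtain ⟨ha1, hb1, hc1⟩ := h a ha b hb c hc h'
  exact ⟨hb1, hc1, ha1⟩

/-- **Hedtke–Murthy 2012, Thm. 3.5**, the case "`S` normal" ("Without loss of generality assume that
`S` is … normal in `G`"): if `(S, T, U)` is a TPP triple of subgroups and `S ⊴ G`, then
`|S|·|T|·|U| ≤ |G|`.  Printed proof: the supports `𝒯 = TS/S`, `𝒰 = US/S` are subgroups of `G/S` with
`|𝒯| = |T|`, `|𝒰| = |U|`, `𝒯 ∩ 𝒰 = 1`, so `|T||U| = |𝒯𝒰| ≤ |G/S|`; here as the same count: the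
map `(t, u) ↦ (tu)S` is injective on `T × U` (from `(tu)S = (t'u')S`, after conjugation,
`z := t⁻¹t'·u'u⁻¹ ∈ S` and `z⁻¹ (t⁻¹t') (u'u⁻¹) = 1` is a TPP word). (Also the tree's
`Murthy2026_prop26_2_subgroup`, same proof.) [cite: HedtkeMurthy2012, Theorem 3.5] -/
theorem HedtkeMurthy2012_thm35_left [Finite G] [hS : S.Normal] (h : SubgroupTPP S T U) :
    Nat.card S * Nat.card T * Nat.card U ≤ Nat.card G := by
  -- `𝒯 𝒰 ⊆ G/S` with `|𝒯 𝒰| = |T| |U|`: the product map `T × U → G ⧸ S` is injective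
  let f : T × U → G ⧸ S := fun x => ((x.1 : G) * (x.2 : G) : G)
  have hf : Function.Injective f := by
    rintro ⟨⟨t, ht⟩, ⟨u, hu⟩⟩ ⟨⟨t', ht'⟩, ⟨u', hu'⟩⟩ he
    have hmem : (t * u)⁻¹ * (t' * u') ∈ S := QuotientGroup.eq.1 he
    -- conjugate by `u`: `z := t⁻¹ t' (u' u⁻¹) ∈ S`, and `z⁻¹ · (t⁻¹ t') · (u' u⁻¹) = 1`
    have hz : t⁻¹ * t' * (u' * u⁻¹) ∈ S := by
      have := hS.conj_mem _ hmem u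
      simpa [mul_assoc, mul_inv_rev] using this
    obtain ⟨-, h2, h3⟩ := h _ (S.inv_mem hz) _ (T.mul_mem (T.inv_mem ht) ht')
      _ (U.mul_mem hu' (U.inv_mem hu)) (by group)
    have htt : t = t' := by
      rw [inv_mul_eq_one] at h2
      exact h2
    have huu : u = u' := by
      rw [mul_inv_eq_one] at h3
      exact h3.symm
    subst htt huu
    rfl
  have hTU : Nat.card T * Nat.card U ≤ Nat.card (G ⧸ S) := by
    rw [← Nat.card_prod]
    exact Nat.card_le_card_of_injective f hf
  calc Nat.card S * Nat.card T * Nat.card U = Nat.card S * (Nat.card T * Nat.card U) := by ring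
    _ ≤ Nat.card S * Nat.card (G ⧸ S) := Nat.mul_le_mul_left _ hTU
    _ = Nat.card G := by rw [mul_comm, ← Subgroup.index_eq_card, Subgroup.index_mul_card]

/-- **Hedtke–Murthy 2012, Thm. 3.5** (as printed): "If `(S,T,U)` is a TPP triple of subgroups where at
least one of `S`, `T` or `U` is normal in `G`, then `|S|·|T|·|U| ≤ |G|`" (reduce to the case `S`
normal by the cyclic symmetry of the TPP). [cite: HedtkeMurthy2012, Theorem 3.5] -/
theorem HedtkeMurthy2012_thm35 [Finite G] (h : SubgroupTPP S T U)
    (hN : S.Normal ∨ T.Normal ∨ U.Normal) :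
    Nat.card S * Nat.card T * Nat.card U ≤ Nat.card G := by
  rcases hN with hS | hT | hU
  · exact HedtkeMurthy2012_thm35_left h
  · have := @HedtkeMurthy2012_thm35_left G _ T U S _ hT (subgroupTPP_rotate' h)
    calc Nat.card S * Nat.card T * Nat.card U = Nat.card T * Nat.card U * Nat.card S := by ring
      _ ≤ Nat.card G := this
  · have := @HedtkeMurthy2012_thm35_left G _ U S T _ hU
      (subgroupTPP_rotate' (subgroupTPP_rotate' h))
    calc Nat.card S * Nat.card T * Nat.card U = Nat.card U * Nat.card S * Nat.card T := by ring
      _ ≤ Nat.card G := this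

end Normal

end Literature.Computability.AlgebraicComplexity
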